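import Literature.NumberTheory.IwasawaTheory.ClassicalMuVanishesQuadraticAscentUnramified
import Literature.NumberTheory.IwasawaTheory.ClassicalMuVanishesImaginaryQuadraticTwoProofs
import Literature.NumberTheory.IwasawaTheory.ClassicalMuVanishesPrimeDegreeGaloisRat
import Literature.NumberTheory.NumberFields.SplitPrimesBaseChange
import Mathlib.NumberTheory.NumberField.Discriminant.Different
import HarnessLib

/-!
# `μ₂ = 0` for EVERY quadratic number field and every cyclotomic `ℤ₂`-extension — the REAL quadratic case by genus theory
# (Chevalley with archimedean factor `1`), the imaginary case from the tree; no Ferrero–Washington (proved; no definition, no named fact)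

`Proofs`-style file (theorems only) in topic `NumberTheory/IwasawaTheory` (namespace `Literature.NumberTheory.IwasawaTheory`), written by the
prover seat `bsd-line-att-p3` g34 (cell `bsd-f1-sign2`; `--supports` stmt-BirchSwinnertonDyer-22298; closes nothing).

THE GAP IT FILLS. The tree proves `μ₂ = 0` for the cyclotomic `ℤ₂`-extension of an IMAGINARY quadratic field
(`classicalMuVanishes_imaginaryQuadratic_cyclotomic_two`, Kida 1979 / Ferrero 1980 by genus theory in the CM tower `K·ℚ_n`) and carries
Ferrero–Washington only as a named fact (`ferreroWashington1979_classicalMuVanishes`). For a REAL quadratic `K' = ℚ(√d)`, `d > 0`, the layers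
`K'·ℚ_n` (`ℚ_n = ℚ(ζ_{2^{n+2}})⁺`) are TOTALLY REAL, so the quadratic extensions `K'·ℚ_n/ℚ_n` are unramified at every infinite place:
Chevalley's ambiguous class number formula has archimedean factor `1` and — `h(ℚ_n)` being odd (Weber / Iwasawa 1956, tree) — gives
`ord₂ #Cl(K'ℚ_n)^G ≤ t_n − 1` with `t_n ≤ T(K') := ∑_{ℓ ∣ d_{K'}} ℓ²` the number of primes of `ℚ_n` ramified in `K'ℚ_n`, whence
`rank₂ Cl(K'ℚ_n) ≤ 2·T(K')` for all `n` and `μ₂ = 0` («`μ = 0` iff bounded ranks», tree). No unit signatures, no narrow class groups,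
no `L`-functions.

* §1 `ncard_ramified_layer_fieldRange_sup_layer_le_two` — for `[K' : ℚ] = 2`, `κ` cyclotomic with `κ ∘ res` onto: at most
  `T(K') = ∑_{ℓ ∣ disc K'} ℓ²` primes of `ℚ_n` ramify in `j'(K')·ℚ_n`, every `n` (the `p = 2` twin of
  `ClassicalMuVanishesCyclicAscentOddRat.ncard_ramified_layer_fieldRange_sup_layer_le`: ramified primes lie over `ℓ ∣ disc K'` by base change,
  and `ℚ_n` has at most `ℓ²` primes above `ℓ`).
* §2 ★ `classGroupPRank_restrict_rat_le_of_isTotallyReal_of_finrank_eq_two` — **`rank₂ Cl((K'ℚ_∞)_n) ≤ 2·T(K')` for every `n`**, `K'` real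
  quadratic with `κ ∘ res` onto; ★ `classicalMuVanishes_restrict_rat_of_isTotallyReal_of_finrank_eq_two` — `μ₂(K'ℚ_∞/K') = 0`.
* §3 ★★ **`classicalMuVanishes_of_isTotallyReal_of_finrank_eq_two`** — EVERY real quadratic `K'`, EVERY cyclotomic `ℤ₂`-extension `κ'` of `K'`:
  `ClassicalMuVanishes κ'` (if `κ ∘ res` is not onto then `K' = ℚ(√2) = ℚ_1` and `e_n = 0`, tree `classicalMuVanishes_of_finrank_eq_prime_of_not_surjective`);
  ★★ **`classicalMuVanishes_of_finrank_eq_two`** — EVERY quadratic number field (a quadratic field is totally real or totally complex; the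
  complex case is the tree's imaginary quadratic theorem).

Intended use (cell bsd-f1-sign2, crux C2 `MainConjectureOfRankZeroBSDAtTwo`, stmt-BirchSwinnertonDyer-22298): the RESOLVENT input
`hk : μ₂(ℚ(√Δ_W)^{cyc}) = 0` of the sign-free `S₃` norm-relation descent (`…SexticNormRelationDescentSignFreeMu`) is now a theorem for BOTH signs
of `Δ_W`.

References: [Iwasawa1973MuInvariants] Thm. 2/3; [Iwasawa1956]; [Washington1997] Thm. 2.13, §13.1, §13.3 Prop. 13.22–13.23; [FerreroWashington1979]
(the abelian theorem this is an elementary case of); [Ferrero1980AJM], [Kida1979Tohoku] (imaginary quadratic); [Greenberg1976TotallyReal] R. Greenberg, *On the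
Iwasawa invariants of totally real number fields*, Amer. J. Math. 98 (1976) (the real quadratic towers; `λ₂ = μ₂ = 0` conjectured);
[OzakiTaya1997] M. Ozaki, H. Taya, *On the Iwasawa λ₂-invariants of certain families of real quadratic fields*, Manuscripta Math. 94 (1997)
(genus theory in `ℚ_n(√d)/ℚ_n`); [NeukirchANT1999] Ch. I §9, Ch. III §2; [Marcus2018] Ch. 4 Thm. 31.
-/

set_option autoImplicit false

noncomputable section

open scoped NumberField Classical
open NumberField NumberField.InfinitePlace Field IntermediateField IsDedekindDomain Module

namespace Literature.NumberTheory.IwasawaTheory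

open Literature.NumberTheory.EllipticCurves Literature.NumberTheory.EllipticCurves.ZpExtension
  Literature.NumberTheory.GaloisRepresentations Literature.NumberTheory.NumberFields

/-! ## §1 The per-layer ramification bound for a quadratic `K'/ℚ` -/

/-- The rational prime under a maximal ideal of a ring of integers. [folklore] -/
private theorem exists_prime_liesOver₂ {L : Type*} [Field L] [NumberField L] (P : Ideal (𝓞 L)) [P.IsMaximal] :
    ∃ q : ℕ, q.Prime ∧ P.LiesOver (Ideal.span {(q : ℤ)}) := by
  have hP0 : P ≠ ⊥ := Ring.ne_bot_of_isMaximal_of_not_isField ‹_› (RingOfIntegers.not_isField L)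
  haveI : (P.under ℤ).IsPrime := Ideal.IsPrime.under ℤ P
  have hPZ0 : P.under ℤ ≠ ⊥ := mt Ideal.eq_bot_of_comap_eq_bot hP0
  set g := Submodule.IsPrincipal.generator (P.under ℤ) with hgdef
  have hg : Ideal.span {g} = P.under ℤ := Ideal.span_singleton_generator (P.under ℤ)
  have hg0 : g ≠ 0 := fun h => hPZ0 (by rw [← hg, h, Ideal.span_singleton_eq_bot])
  have hgprime : Prime g := (Ideal.span_singleton_prime hg0).mp (hg.symm ▸ inferInstance)
  refine ⟨g.natAbs, Int.prime_iff_natAbs_prime.mp hgprime, ⟨?_⟩⟩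
  rw [Int.span_natAbs, hg]

/-- **At most `T(K') = ∑_{ℓ ∣ disc K'} ℓ²` primes of `ℚ_n` ramify in `j'(K')·ℚ_n`, for every `n`** (`[K' : ℚ] = 2`, `κ ∘ res` onto, `κ`
cyclotomic): `j'(K')·ℚ_n` is Galois over `ℚ_n` of degree `2`, generated by the image of `K'`; a prime `v` of `ℚ_n` ramified in it lies over a
rational prime `q` ramified in `K'` (base change, tree `isUnramifiedIn_of_isUnramifiedIn_span`), i.e. `q ∣ disc K'` (Mathlib), and `ℚ_n` has
at most `q²` primes above `q` (`ℚ_n ⊆ ℚ(ζ_{2^{n+2}})`, tree `ncard_primesOver_layer_two_le_sq`). The `p = 2` twin of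
`ncard_ramified_layer_fieldRange_sup_layer_le`. [cite: NeukirchANT1999, Ch. III §2 Thm. (2.6) and Cor. (2.12) (ramified primes divide the discriminant)]
[cite: Marcus2018, Ch. 4 Thm. 31] [cite: Washington1997, Thm. 2.13 and §13.1] -/
theorem ncard_ramified_layer_fieldRange_sup_layer_le_two {κ : ZpExtension ℚ 2} (hκ : κ.IsCyclotomic)
    (K' : Type) [Field K'] [NumberField K'] (hdeg : Module.finrank ℚ K' = 2)
    (hK' : Function.Surjective (κ.toContinuousMonoidHom.comp (absGaloisRestrict ℚ K')))
    (j' : K' →ₐ[ℚ] AlgebraicClosure ℚ) (n : ℕ) :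
    letI : Algebra ↥(κ.layer n) ↥(j'.fieldRange ⊔ κ.layer n) :=
      (IntermediateField.inclusion (le_sup_right : κ.layer n ≤ j'.fieldRange ⊔ κ.layer n)).toRingHom.toAlgebra
    {v : HeightOneSpectrum (𝓞 ↥(κ.layer n)) |
        v.asIdeal.ramificationIdxIn (𝓞 ↥(j'.fieldRange ⊔ κ.layer n)) ≠ 1}.ncard ≤
      ∑ ℓ ∈ (NumberField.discr K').natAbs.primeFactors, ℓ ^ 2 := by
  classical
  haveI : Fact (Nat.Prime 2) := ⟨Nat.prime_two⟩
  haveI : Algebra.IsQuadraticExtension ℚ K' := ⟨hdeg⟩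
  haveI : IsGalois ℚ K' := inferInstance
  haveI : FiniteDimensional ℚ ↥(κ.layer n) := κ.finiteDimensional_layer_holds n
  haveI : NumberField ↥(κ.layer n) := NumberField.of_module_finite ℚ _
  haveI : NumberField ↥(j'.fieldRange ⊔ κ.layer n) := numberField_fieldRange_sup_layer κ K' j' n
  have hle : κ.layer n ≤ j'.fieldRange ⊔ κ.layer n := le_sup_right
  letI algL : Algebra ↥(κ.layer n) ↥(j'.fieldRange ⊔ κ.layer n) := (IntermediateField.inclusion hle).toRingHom.toAlgebra
  haveI : IsScalarTower ℚ ↥(κ.layer n) ↥(j'.fieldRange ⊔ κ.layer n) := IsScalarTower.of_algebraMap_eq fun _ => rfl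
  let eK : K' →+* ↥(j'.fieldRange ⊔ κ.layer n) :=
    (j' : K' →+* AlgebraicClosure ℚ).codRestrict (j'.fieldRange ⊔ κ.layer n) fun x =>
      (le_sup_left : j'.fieldRange ≤ j'.fieldRange ⊔ κ.layer n) (j'.mem_fieldRange.mpr ⟨x, rfl⟩)
  letI algK : Algebra K' ↥(j'.fieldRange ⊔ κ.layer n) := eK.toAlgebra
  haveI : Module.Free ↥(κ.layer n) ↥(j'.fieldRange ⊔ κ.layer n) := Module.Free.of_divisionRing _ _
  haveI : FiniteDimensional ↥(κ.layer n) ↥(j'.fieldRange ⊔ κ.layer n) :=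
    Module.Finite.of_restrictScalars_finite ℚ ↥(κ.layer n) ↥(j'.fieldRange ⊔ κ.layer n)
  -- `[L : ℚ_n] = 2`, `L/ℚ_n` Galois
  have hdegL : Module.finrank ↥(κ.layer n) ↥(j'.fieldRange ⊔ κ.layer n) = 2 :=
    (finrank_layer_fieldRange_sup_layer κ K' hK' j' n).trans hdeg
  haveI : IsGalois ↥(κ.layer n) ↥(j'.fieldRange ⊔ κ.layer n) := isGalois_layer_fieldRange_sup_layer κ K' j' n
  haveI : IsGaloisGroup (↥(j'.fieldRange ⊔ κ.layer n) ≃ₐ[↥(κ.layer n)] ↥(j'.fieldRange ⊔ κ.layer n)) (𝓞 ↥(κ.layer n))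
      (𝓞 ↥(j'.fieldRange ⊔ κ.layer n)) :=
    IsGaloisGroup.of_isFractionRing _ _ _ (↥(κ.layer n)) ↥(j'.fieldRange ⊔ κ.layer n)
  -- `L` is generated over `ℚ_n` by the image of `K'` (prime degree; `K' ⊄ ℚ_n` by the degree count)
  have hgen : IntermediateField.adjoin (↥(κ.layer n)) (Set.range (algebraMap K' ↥(j'.fieldRange ⊔ κ.layer n))) = ⊤ := by
    set E := IntermediateField.adjoin (↥(κ.layer n)) (Set.range (algebraMap K' ↥(j'.fieldRange ⊔ κ.layer n))) with hE
    have h2 : (Module.finrank (↥(κ.layer n)) ↥(j'.fieldRange ⊔ κ.layer n)).Prime := by rw [hdegL]; exact Nat.prime_two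
    haveI := IntermediateField.isSimpleOrder_of_finrank_prime (↥(κ.layer n)) ↥(j'.fieldRange ⊔ κ.layer n) h2
    rcases eq_bot_or_eq_top E with h | h
    · exfalso
      -- `j'(K') ⊆ ℚ_n` would give `[j'(K')·ℚ_n : ℚ] = 2ⁿ`, not `2·2ⁿ`
      have hsub : j'.fieldRange ≤ κ.layer n := by
        rintro _ ⟨x, rfl⟩
        have hx : algebraMap K' ↥(j'.fieldRange ⊔ κ.layer n) x ∈
            (⊥ : IntermediateField ↥(κ.layer n) ↥(j'.fieldRange ⊔ κ.layer n)) :=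
          h ▸ IntermediateField.subset_adjoin _ _ ⟨x, rfl⟩
        obtain ⟨y, hy⟩ := IntermediateField.mem_bot.mp hx
        have hy' : ((y : ↥(κ.layer n)) : AlgebraicClosure ℚ) = j' x := by
          have := congrArg (fun z : ↥(j'.fieldRange ⊔ κ.layer n) => (z : AlgebraicClosure ℚ)) hy
          exact this
        exact hy' ▸ y.2
      have heq : j'.fieldRange ⊔ κ.layer n = κ.layer n := sup_eq_right.mpr hsub
      have h1 : Module.finrank ℚ ↥(j'.fieldRange ⊔ κ.layer n) = Module.finrank ℚ K' * 2 ^ n :=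
        finrank_fieldRange_sup_layer κ K' hK' j' n
      have h2' : Module.finrank ℚ ↥(j'.fieldRange ⊔ κ.layer n) = 2 ^ n := by
        rw [(IntermediateField.equivOfEq heq).toLinearEquiv.finrank_eq]; exact κ.finrank_layer_holds n
      rw [h2', hdeg] at h1
      have : 2 ^ n * 1 = 2 ^ n * 2 := by rw [mul_one, mul_comm]; exact h1
      exact absurd (Nat.eq_of_mul_eq_mul_left (pow_pos two_pos n) this) (by norm_num)
    · exact h
  -- every ramified prime of `ℚ_n` lies over a prime factor of `disc K'`
  set P := (NumberField.discr K').natAbs.primeFactors with hP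
  have hdisc : NumberField.discr K' ≠ 0 := NumberField.discr_ne_zero K'
  have hcover : {v : HeightOneSpectrum (𝓞 ↥(κ.layer n)) |
      v.asIdeal.ramificationIdxIn (𝓞 ↥(j'.fieldRange ⊔ κ.layer n)) ≠ 1} ⊆
      ⋃ ℓ ∈ P, {v : HeightOneSpectrum (𝓞 ↥(κ.layer n)) | v.asIdeal ∈ (Ideal.span {(ℓ : ℤ)}).primesOver (𝓞 ↥(κ.layer n))} := by
    intro v hv
    haveI := v.isPrime
    obtain ⟨⟨Q, hQ, hQv⟩⟩ := v.asIdeal.nonempty_primesOver (S := 𝓞 ↥(j'.fieldRange ⊔ κ.layer n))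
    haveI := hQ; haveI := hQv
    haveI : Q.IsMaximal := hQ.isMaximal (Ideal.ne_bot_of_liesOver_of_ne_bot v.ne_bot Q)
    obtain ⟨q, hq, hQq⟩ := exists_prime_liesOver₂ Q
    haveI := hQq; haveI : Fact q.Prime := ⟨hq⟩
    have hvq : v.asIdeal.LiesOver (Ideal.span {(q : ℤ)}) := Ideal.LiesOver.tower_bot Q v.asIdeal (Ideal.span {(q : ℤ)})
    have hvq' : ((q : ℕ) : 𝓞 ↥(κ.layer n)) ∈ v.asIdeal := by
      have : ((q : ℤ) : ℤ) ∈ Ideal.span {(q : ℤ)} := Ideal.mem_span_singleton_self _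
      rw [hvq.over, Ideal.under_def, Ideal.mem_comap] at this
      simpa using this
    have hnot : ¬ Algebra.IsUnramifiedIn (𝓞 ↥(j'.fieldRange ⊔ κ.layer n)) v.asIdeal := fun hunr =>
      hv ((Ideal.ramificationIdxIn_eq_ramificationIdx v.asIdeal Q
        (↥(j'.fieldRange ⊔ κ.layer n) ≃ₐ[↥(κ.layer n)] ↥(j'.fieldRange ⊔ κ.layer n))).trans
          (hunr.ramificationIdx_eq_one hQv))
    have hqK : ¬ Algebra.IsUnramifiedIn (𝓞 K') (Ideal.span {(q : ℤ)}) := fun hK'' =>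
      hnot (isUnramifiedIn_of_isUnramifiedIn_span hgen hq hK'' v hvq')
    have hqd : (q : ℤ) ∣ NumberField.discr K' := by
      by_contra hnd
      exact hqK ((NumberField.not_dvd_discr_iff_isUnramifiedIn K' (𝓞 K') (Nat.prime_iff_prime_int.mp hq)).mp hnd)
    refine Set.mem_biUnion (x := q) ?_ ?_
    · exact Nat.mem_primeFactors.mpr ⟨hq, Int.natAbs_dvd_natAbs.mpr hqd |>.trans (by simp), Int.natAbs_ne_zero.mpr hdisc⟩
    · exact ⟨v.isPrime, hvq⟩
  have hfin : ∀ ℓ ∈ P,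
      ({v : HeightOneSpectrum (𝓞 ↥(κ.layer n)) | v.asIdeal ∈ (Ideal.span {(ℓ : ℤ)}).primesOver (𝓞 ↥(κ.layer n))}).Finite ∧
      ({v : HeightOneSpectrum (𝓞 ↥(κ.layer n)) | v.asIdeal ∈ (Ideal.span {(ℓ : ℤ)}).primesOver (𝓞 ↥(κ.layer n))}).ncard ≤ ℓ ^ 2 := by
    intro ℓ hℓ
    have hℓp : ℓ.Prime := Nat.prime_of_mem_primeFactors hℓ
    haveI : Fact ℓ.Prime := ⟨hℓp⟩
    haveI : (Ideal.span {(ℓ : ℤ)}).IsMaximal := Int.ideal_span_isMaximal_of_prime ℓ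
    have hinj : Set.InjOn (fun v : HeightOneSpectrum (𝓞 ↥(κ.layer n)) => v.asIdeal)
        {v | v.asIdeal ∈ (Ideal.span {(ℓ : ℤ)}).primesOver (𝓞 ↥(κ.layer n))} := fun v _ v' _ h => HeightOneSpectrum.ext h
    have hmaps : Set.MapsTo (fun v : HeightOneSpectrum (𝓞 ↥(κ.layer n)) => v.asIdeal)
        {v | v.asIdeal ∈ (Ideal.span {(ℓ : ℤ)}).primesOver (𝓞 ↥(κ.layer n))}
        ((Ideal.span {(ℓ : ℤ)}).primesOver (𝓞 ↥(κ.layer n))) := fun v hv => hv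
    have hfinT : ((Ideal.span {(ℓ : ℤ)}).primesOver (𝓞 ↥(κ.layer n))).Finite := IsDedekindDomain.primesOver_finite _ _
    refine ⟨Set.Finite.of_injOn hmaps hinj hfinT, ?_⟩
    calc ({v : HeightOneSpectrum (𝓞 ↥(κ.layer n)) | v.asIdeal ∈ (Ideal.span {(ℓ : ℤ)}).primesOver (𝓞 ↥(κ.layer n))}).ncard
        ≤ ((Ideal.span {(ℓ : ℤ)}).primesOver (𝓞 ↥(κ.layer n))).ncard := Set.ncard_le_ncard_of_injOn _ hmaps hinj hfinT
      _ ≤ ℓ ^ 2 := ncard_primesOver_layer_two_le_sq hκ n hℓp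
  calc {v : HeightOneSpectrum (𝓞 ↥(κ.layer n)) | v.asIdeal.ramificationIdxIn (𝓞 ↥(j'.fieldRange ⊔ κ.layer n)) ≠ 1}.ncard
      ≤ (⋃ ℓ ∈ P, {v : HeightOneSpectrum (𝓞 ↥(κ.layer n)) |
          v.asIdeal ∈ (Ideal.span {(ℓ : ℤ)}).primesOver (𝓞 ↥(κ.layer n))}).ncard :=
        Set.ncard_le_ncard hcover (Set.Finite.biUnion P.finite_toSet fun ℓ hℓ => (hfin ℓ hℓ).1)
    _ ≤ ∑ ℓ ∈ P, ({v : HeightOneSpectrum (𝓞 ↥(κ.layer n)) |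
          v.asIdeal ∈ (Ideal.span {(ℓ : ℤ)}).primesOver (𝓞 ↥(κ.layer n))}).ncard := Finset.set_ncard_biUnion_le P _
    _ ≤ ∑ ℓ ∈ P, ℓ ^ 2 := Finset.sum_le_sum fun ℓ hℓ => (hfin ℓ hℓ).2

/-! ## §2 Real quadratic `K'` linearly disjoint from `ℚ_∞`: the rank bound and `μ₂ = 0` -/

/-- ★ **`rank₂ Cl((K'ℚ_∞)_n) ≤ 2·T(K')` for every `n`**, `K'` a REAL quadratic field with `κ ∘ res` onto (`κ` the cyclotomic `ℤ₂`-extension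
of `ℚ`), `T(K') = ∑_{ℓ ∣ disc K'} ℓ²`: the layers `j'(K')·ℚ_n` are totally real, so Chevalley's formula for the quadratic extension
`j'(K')·ℚ_n / ℚ_n` has archimedean factor `1` (`classGroupPRank_restrict_le_of_finrank_eq_two_of_isUnramifiedAtInfinitePlaces`); the base term
`rank₂ Cl(ℚ_n)` vanishes (Weber / Iwasawa 1956, tree `classGroupPRank_rat_eq_zero`) and §1 bounds the ramified primes.
[cite: Iwasawa1973MuInvariants, Thm. 2 and its proof] [cite: Washington1997, §13.3 (proof of Prop. 13.23) and Prop. 13.22]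
[cite: OzakiTaya1997, §2 (genus theory in ℚ_n(√d)/ℚ_n)] -/
theorem classGroupPRank_restrict_rat_le_of_isTotallyReal_of_finrank_eq_two {κ : ZpExtension ℚ 2} (hκ : κ.IsCyclotomic)
    (K' : Type) [Field K'] [NumberField K'] [IsTotallyReal K'] (hdeg : Module.finrank ℚ K' = 2)
    (hK' : Function.Surjective (κ.toContinuousMonoidHom.comp (absGaloisRestrict ℚ K'))) (n : ℕ) :
    classGroupPRank (κ.restrict K' hK') n ≤ 2 * ∑ ℓ ∈ (NumberField.discr K').natAbs.primeFactors, ℓ ^ 2 := by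
  haveI : Fact (Nat.Prime 2) := ⟨Nat.prime_two⟩
  set j' : K' →ₐ[ℚ] AlgebraicClosure ℚ := absEmbedding ℚ K' with hj'
  have hinf : (letI : Algebra ↥(κ.layer n) ↥(j'.fieldRange ⊔ κ.layer n) :=
        (IntermediateField.inclusion (le_sup_right : κ.layer n ≤ j'.fieldRange ⊔ κ.layer n)).toRingHom.toAlgebra
      IsUnramifiedAtInfinitePlaces ↥(κ.layer n) ↥(j'.fieldRange ⊔ κ.layer n)) := by
    letI : Algebra ↥(κ.layer n) ↥(j'.fieldRange ⊔ κ.layer n) :=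
      (IntermediateField.inclusion (le_sup_right : κ.layer n ≤ j'.fieldRange ⊔ κ.layer n)).toRingHom.toAlgebra
    haveI : NumberField ↥(j'.fieldRange ⊔ κ.layer n) := numberField_fieldRange_sup_layer κ K' j' n
    haveI : IsTotallyReal ↥(j'.fieldRange ⊔ κ.layer n) := isTotallyReal_fieldRange_sup_layer κ K' j' n
    exact isUnramifiedAtInfinitePlaces_of_isTotallyReal _ _
  have h := classGroupPRank_restrict_le_of_finrank_eq_two_of_isUnramifiedAtInfinitePlaces κ K' hdeg hK' j' n _
    (ncard_ramified_layer_fieldRange_sup_layer_le_two hκ K' hdeg hK' j' n) hinf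
  rwa [classGroupPRank_rat_eq_zero κ n, mul_zero, zero_add] at h

/-- ★ **`μ₂ = 0` for `K'·ℚ_∞/K'`**, `K'` REAL quadratic with `κ ∘ res` onto (`κ` the cyclotomic `ℤ₂`-extension of `ℚ` restricted to `Γ_{K'}`):
bounded `2`-ranks (§2) ⟹ `μ = 0` in growth form (tree `classicalMuVanishes_of_forall_classGroupPRank_le`, Washington Prop. 13.23 at finite level).
[cite: Iwasawa1973MuInvariants, Thm. 2 and Thm. 3] [cite: Washington1997, §13.3 Prop. 13.23] [cite: Greenberg1976TotallyReal, §1 (the towers ℚ_n(√d))] -/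
theorem classicalMuVanishes_restrict_rat_of_isTotallyReal_of_finrank_eq_two {κ : ZpExtension ℚ 2} (hκ : κ.IsCyclotomic)
    (K' : Type) [Field K'] [NumberField K'] [IsTotallyReal K'] (hdeg : Module.finrank ℚ K' = 2)
    (hK' : Function.Surjective (κ.toContinuousMonoidHom.comp (absGaloisRestrict ℚ K'))) :
    ClassicalMuVanishes (κ.restrict K' hK') :=
  classicalMuVanishes_of_forall_classGroupPRank_le _ (classGroupPRank_restrict_rat_le_of_isTotallyReal_of_finrank_eq_two hκ K' hdeg hK')

/-! ## §3 Intrinsic forms: every real quadratic field, every quadratic field -/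

/-- ★★ **`μ₂ = 0` for EVERY real quadratic field and EVERY cyclotomic `ℤ₂`-extension of it** (growth form: `ord₂ h(K'_n) = λ n + ν` for
`n ≫ 0`). If `κ ∘ res_{K'/ℚ}` is onto (`√2 ∉ K'`) this is §2 transported to `κ'` (`classicalMuVanishes_iff_of_isCyclotomic`); otherwise `K'` is
the first layer `ℚ_1 = ℚ(√2)` and `e_n = 0` for all `n` (tree `classicalMuVanishes_of_finrank_eq_prime_of_not_surjective`). The real quadratic
case of Ferrero–Washington, by genus theory alone. [cite: FerreroWashington1979, Thm. (abelian K; here K real quadratic, p = 2)]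
[cite: Iwasawa1973MuInvariants, Thm. 2 and Thm. 3] [cite: Washington1997, §13.3 Prop. 13.23 and Prop. 13.22] [cite: Greenberg1976TotallyReal, §1] -/
theorem classicalMuVanishes_of_isTotallyReal_of_finrank_eq_two (K' : Type) [Field K'] [NumberField K'] [IsTotallyReal K']
    (hdeg : Module.finrank ℚ K' = 2) (κ' : ZpExtension K' 2) (hκ' : κ'.IsCyclotomic) : ClassicalMuVanishes κ' := by
  haveI : Fact (Nat.Prime 2) := ⟨Nat.prime_two⟩
  have hcyc := CyclotomicZp.isCyclotomic_zpExtension 2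
  by_cases hK : Function.Surjective ((CyclotomicZp.zpExtension 2).toContinuousMonoidHom.comp (absGaloisRestrict ℚ K'))
  · exact (classicalMuVanishes_iff_of_isCyclotomic κ' _ hκ'
      (isCyclotomic_restrict (CyclotomicZp.zpExtension 2) hcyc K' hK)).mpr
        (classicalMuVanishes_restrict_rat_of_isTotallyReal_of_finrank_eq_two hcyc K' hdeg hK)
  · exact classicalMuVanishes_of_finrank_eq_prime_of_not_surjective hcyc K' hdeg hK κ' hκ'

/-- A Galois number field is totally real or totally complex: two complex embeddings differ by an automorphism
(adapted from the private `isTotallyReal_or_isTotallyComplex_tcy` of `Automorphic/Arthur2013/Leaves/TorusCyclotomic`). [folklore] -/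
private theorem isTotallyReal_or_isTotallyComplex (K : Type) [Field K] [NumberField K] [IsGalois ℚ K] :
    IsTotallyReal K ∨ IsTotallyComplex K := by
  by_cases h : ∃ φ : K →+* ℂ, ComplexEmbedding.IsReal φ
  · obtain ⟨φ, hφ⟩ := h
    left
    refine ⟨fun w => ?_⟩
    rw [← InfinitePlace.mk_embedding w, InfinitePlace.isReal_mk_iff]
    obtain ⟨σ, hσ⟩ := InfinitePlace.ComplexEmbedding.exists_comp_symm_eq_of_comp_eq (k := ℚ) φ w.embedding
      (by ext; simp)
    rw [← hσ]
    exact hφ.comp _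
  · right
    refine ⟨fun w => ?_⟩
    rw [← InfinitePlace.not_isReal_iff_isComplex, ← InfinitePlace.mk_embedding w, InfinitePlace.isReal_mk_iff]
    exact fun hw => h ⟨w.embedding, hw⟩

/-- ★★ **`μ₂ = 0` for EVERY quadratic number field and EVERY cyclotomic `ℤ₂`-extension of it** (Ferrero–Washington for `[K' : ℚ] = 2`,
`p = 2`, as a tree theorem with no `L`-function input): a quadratic field is Galois, hence totally real (§3, genus theory in the totally real
towers `K'ℚ_n/ℚ_n`) or totally complex (the tree's `classicalMuVanishes_imaginaryQuadratic_cyclotomic_two`, genus theory in the CM towers).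
[cite: FerreroWashington1979, Thm. (abelian K; here [K : ℚ] = 2, p = 2)] [cite: Ferrero1980AJM, Thm.] [cite: Kida1979Tohoku, Thm. 1]
[cite: Washington1997, §13.3 Prop. 13.23] -/
theorem classicalMuVanishes_of_finrank_eq_two (K' : Type) [Field K'] [NumberField K'] (hdeg : Module.finrank ℚ K' = 2)
    (κ' : ZpExtension K' 2) (hκ' : κ'.IsCyclotomic) : ClassicalMuVanishes κ' := by
  haveI : Algebra.IsQuadraticExtension ℚ K' := ⟨hdeg⟩
  haveI : IsGalois ℚ K' := inferInstance
  rcases isTotallyReal_or_isTotallyComplex K' with h | h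
  · haveI := h
    exact classicalMuVanishes_of_isTotallyReal_of_finrank_eq_two K' hdeg κ' hκ'
  · haveI := h
    exact classicalMuVanishes_imaginaryQuadratic_cyclotomic_two K' ⟨hdeg, h⟩ κ' hκ'

end Literature.NumberTheory.IwasawaTheory

end
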